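import Summits.ResolutionOfSingularities.ResolutionOfSingularities.Theorems.MarkedTransferCampaignW21MinDegreeTop
import Literature.RingTheory.MvPowerSeries.HasseDerivOrder
import Mathlib.RingTheory.MvPowerSeries.Order
import Mathlib.Data.ZMod.Basic
import HarnessLib

/-!
# [OURS · L1 W2.1] The centre-witness SERIES `ε = y^{p−1} ω₁^{p+1} ω₂^{p} + y^{p−1} ω₁ ω₂^{2p} + ω₁^{p} ω₂^{p²+p} ∈ 𝔽_p⟦y, ω₁, ω₂⟧`
# and its Case-(I) diff-product `∂^{(p−1,1,0)}ε · ∂^{(0,p,p)}ε = ε + ω₂^{p²+2p}` (every prime `p`)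

Rung L (rescue) of cell res-hironaka, RESCUE-SEED row L-G2, slot W2.1 (hypothesis mining for the order bound of the
diff-product `H♭`), seat res-L1-s21-pv-1 — the USE half of the slot («every ε(i) of Lem 16.7/16.8 shape, ord_D ε(i) ≥
p^{e−i}, lies in the class»). The §16 use of the order bound (p.85 L10–L11 of the manuscript under adjudication, typed
AS PRINTED as `S16Proof.U85L8` (b): «ord_D(h(i)) ≥ ord_D(ϵ(i)) ≥ p^{e−i}») is D-ADIC — the order ALONG the blow-up centre
`D ∋ ξ` (tree rendering `S09LLUED.ordAlong`; Th. 9.3 p.47 L33 «ord_D(h) ≥ q») — whereas the W2.1 classes (`MinDegreeTop`,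
`LucasClass`, `ExactClass`, …; `MarkedTransferCampaignW21OrderBoundInClass.lean`, res-L1-type-o3) were mined for the
order AT `ξ`.

THIS FILE: the series (three variables `y = X 0`, `ω₁ = X 1`, `ω₂ = X 2` over `K = 𝔽_p`), exponent plumbing `e3 a b c`
on `Fin 3`, and the computations `∂^{(p−1,1,0)}ε = ω₁^pω₂^p + ω₂^{2p}` (binomials `C(p+1,1) = p+1 ≡ 1`),
`∂^{(0,p,p)}ε = y^{p−1}ω₁ + ω₂^{p²}` (binomials `C(p+1,p) = p+1 ≡ 1`, `C(p²+p,p) ≡ C(p+1,1) ≡ 1` by one Lucas step),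
their product `= ε + ω₂^{p²+2p}`, `ord ε = 3p = ord (ε + ω₂^{p²+2p})`. The standard-expression datum, its top frontier,
`Standing`, the case analysis and the class memberships are in `MarkedTransferCampaignW21AlongCentreWitness.lean`; the
consequences ALONG the centre `D = V(y, ω₁)` in `MarkedTransferCampaignW21AlongCentreRefutation.lean`. Everything here
is OURS / folklore about an OURS datum; nothing is a statement of or about the manuscript under adjudication; AI-produced
formalisation, expert review is stronger than AI review.
-/

noncomputable section

set_option linter.dupNamespace false -- mandated namespace of this single-conjunct summit

namespace Summit.ResolutionOfSingularities.ResolutionOfSingularities.Theorems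

namespace CampaignW21

open Literature.AlgebraicGeometry.Hironaka2017.S08UnitMonomial
open Literature.AlgebraicGeometry.Hironaka2017.S09LLUED
open Literature.AlgebraicGeometry.Hironaka2017.S09LLUED.TopFrontier
open Literature.AlgebraicGeometry.Resolution
open Literature.RingTheory.MvPowerSeries
open MvPowerSeries Finsupp

namespace AlongCentreWitness

variable (p : ℕ) [hp : Fact p.Prime]

/-- `R = 𝔽_p⟦X 0, X 1, X 2⟧` (`y = X 0`, `ω₁ = X 1`, `ω₂ = X 2`). [folklore] -/
abbrev R : Type := MvPowerSeries (Fin 3) (ZMod p)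

/-- The witness `ε = y^{p−1} ω₁^{p+1} ω₂^{p} + y^{p−1} ω₁ ω₂^{2p} + ω₁^{p} ω₂^{p²+p}`. [folklore] -/
def eps : R p :=
  X 0 ^ (p - 1) * X 1 ^ (p + 1) * X 2 ^ p + X 0 ^ (p - 1) * X 1 * X 2 ^ (2 * p) + X 1 ^ p * X 2 ^ (p ^ 2 + p)

/-- Exponent `(a, b, c) ↦ y^a ω₁^b ω₂^c` on `Fin 3`. [folklore] -/
abbrev e3 (a b c : ℕ) : Fin 3 →₀ ℕ := single 0 a + single 1 b + single 2 c

omit hp in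
/-- [folklore] -/
theorem e3_apply_zero (a b c : ℕ) : e3 a b c 0 = a := by simp [e3]
omit hp in
/-- [folklore] -/
theorem e3_apply_one (a b c : ℕ) : e3 a b c 1 = b := by simp [e3]
omit hp in
/-- [folklore] -/
theorem e3_apply_two (a b c : ℕ) : e3 a b c 2 = c := by simp [e3]

omit hp in
/-- [folklore] -/
theorem e3_eq_iff {a b c a' b' c' : ℕ} : e3 a b c = e3 a' b' c' ↔ a = a' ∧ b = b' ∧ c = c' :=
  ⟨fun h => ⟨by simpa [e3_apply_zero] using DFunLike.congr_fun h 0,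
    by simpa [e3_apply_one] using DFunLike.congr_fun h 1,
    by simpa [e3_apply_two] using DFunLike.congr_fun h 2⟩, fun h => by rw [h.1, h.2.1, h.2.2]⟩

omit hp in
/-- [folklore] -/
theorem e3_le_iff {a b c a' b' c' : ℕ} : e3 a b c ≤ e3 a' b' c' ↔ a ≤ a' ∧ b ≤ b' ∧ c ≤ c' := by
  rw [Finsupp.le_def]
  constructor
  · intro h
    exact ⟨by simpa [e3_apply_zero] using h 0, by simpa [e3_apply_one] using h 1,
      by simpa [e3_apply_two] using h 2⟩
  · rintro ⟨ha, hb, hc⟩ i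
    fin_cases i
    · simpa [e3_apply_zero] using ha
    · simpa [e3_apply_one] using hb
    · simpa [e3_apply_two] using hc

omit hp in
/-- [folklore] -/
theorem e3_add (a b c a' b' c' : ℕ) : e3 a b c + e3 a' b' c' = e3 (a + a') (b + b') (c + c') := by
  ext i; fin_cases i <;> simp [e3]

omit hp in
/-- [folklore] -/
theorem e3_degree (a b c : ℕ) : (e3 a b c).degree = a + b + c := by
  simp [e3, map_add, degree_single]

omit hp in
/-- [folklore] -/
theorem e3_zero : e3 0 0 0 = 0 := by simp [e3]

omit hp in
/-- [folklore] -/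
theorem smul_e3 (k a b c : ℕ) : k • e3 a b c = e3 (k * a) (k * b) (k * c) := by
  ext i; fin_cases i <;> simp [e3]

/-- [folklore] -/
theorem X0_pow_eq (k : ℕ) : (X 0 : R p) ^ k = monomial (e3 k 0 0) 1 := by rw [X_pow_eq]; simp [e3]
/-- [folklore] -/
theorem X1_pow_eq (k : ℕ) : (X 1 : R p) ^ k = monomial (e3 0 k 0) 1 := by rw [X_pow_eq]; simp [e3]
/-- [folklore] -/
theorem X2_pow_eq (k : ℕ) : (X 2 : R p) ^ k = monomial (e3 0 0 k) 1 := by rw [X_pow_eq]; simp [e3]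
/-- [folklore] -/
theorem X1_eq : (X 1 : R p) = monomial (e3 0 1 0) 1 := by rw [← pow_one (X 1 : R p), X1_pow_eq]

/-- `ε` as a sum of three monomials. [folklore] -/
theorem eps_eq : eps p = monomial (e3 (p - 1) (p + 1) p) 1 + monomial (e3 (p - 1) 1 (2 * p)) 1 +
    monomial (e3 0 p (p ^ 2 + p)) 1 := by
  simp only [eps, X0_pow_eq, X1_pow_eq, X2_pow_eq]
  rw [X1_eq]
  simp only [monomial_mul_monomial, e3_add, mul_one, add_zero, zero_add]

/-- Coefficients of monomials. [folklore] -/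
theorem coeff_e3_monomial (a b c a' b' c' : ℕ) (d : ZMod p) :
    coeff (e3 a b c) (monomial (e3 a' b' c') d : R p) = if a = a' ∧ b = b' ∧ c = c' then d else 0 := by
  classical
  rw [coeff_monomial]
  by_cases h : a = a' ∧ b = b' ∧ c = c'
  · rw [if_pos (e3_eq_iff.2 h), if_pos h]
  · rw [if_neg (fun h' => h (e3_eq_iff.1 h')), if_neg h]

/-- Divided derivatives of monomials `d·y^a ω₁^b ω₂^c` (additive indexing). [folklore] -/
theorem hasseDeriv_e3_monomial_of_le {a b c a' b' c' : ℕ} (ha : a' ≤ a) (hb : b' ≤ b) (hc : c' ≤ c) (d : ZMod p) :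
    hasseDeriv (e3 a' b' c') (monomial (e3 a b c) d : R p) =
      monomial (e3 (a - a') (b - b') (c - c')) (((a.choose a' * b.choose b' * c.choose c' : ℕ) : ZMod p) * d) := by
  have hsplit : e3 a b c = e3 a' b' c' + e3 (a - a') (b - b') (c - c') := by
    rw [e3_add, Nat.add_sub_cancel' ha, Nat.add_sub_cancel' hb, Nat.add_sub_cancel' hc]
  rw [hsplit, hasseDeriv_monomial_add', prod_choose_eq, Fin.prod_univ_three]
  simp only [e3_apply_zero, e3_apply_one, e3_apply_two, Nat.add_sub_cancel' ha, Nat.add_sub_cancel' hb,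
    Nat.add_sub_cancel' hc]

/-- [folklore] -/
theorem hasseDeriv_e3_monomial_of_not_le {a b c a' b' c' : ℕ} (h : ¬ (a' ≤ a ∧ b' ≤ b ∧ c' ≤ c)) (d : ZMod p) :
    hasseDeriv (e3 a' b' c') (monomial (e3 a b c) d : R p) = 0 :=
  hasseDeriv_monomial_of_not_le' (fun h' => h (e3_le_iff.1 h')) d

/-- `p + 1 = 1` in `𝔽_p`. [folklore] -/
theorem natCast_succ_p : ((p + 1 : ℕ) : ZMod p) = 1 := by
  rw [Nat.cast_add, ZMod.natCast_self, zero_add, Nat.cast_one]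

/-- `C(p² + p, p) ≡ p + 1 ≡ 1 (mod p)` (Lucas). [folklore] -/
theorem natCast_choose_sq_add : (((p ^ 2 + p).choose p : ℕ) : ZMod p) = 1 := by
  have h2 : (p ^ 2 + p) = p * (p + 1) := by ring
  have hp0 : 0 < p := hp.out.pos
  have hl := Choose.choose_modEq_choose_mod_mul_choose_div_nat (n := p ^ 2 + p) (k := p) (p := p)
  have hmod : (p ^ 2 + p) % p = 0 := by rw [h2, Nat.mul_mod_right]
  have hdiv : (p ^ 2 + p) / p = p + 1 := by rw [h2, Nat.mul_div_cancel_left _ hp0]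
  rw [hmod, hdiv, Nat.mod_self, Nat.div_self hp0, Nat.choose_zero_right, one_mul, Nat.choose_one_right] at hl
  rw [(ZMod.natCast_eq_natCast_iff' _ _ _).2 hl, natCast_succ_p]

/-- `∂^{(p−1,1,0)} ε = ω₁^p ω₂^p + ω₂^{2p}`. [folklore] -/
theorem hd_A : hasseDeriv (e3 (p - 1) 1 0) (eps p) = monomial (e3 0 p p) 1 + monomial (e3 0 0 (2 * p)) 1 := by
  have h1 : 1 < p := hp.out.one_lt
  rw [eps_eq, map_add, map_add, hasseDeriv_e3_monomial_of_le p le_rfl (by omega) (Nat.zero_le _),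
    hasseDeriv_e3_monomial_of_le p le_rfl le_rfl (Nat.zero_le _),
    hasseDeriv_e3_monomial_of_not_le p (by omega)]
  simp only [Nat.choose_self, Nat.choose_one_right, Nat.choose_zero_right, Nat.sub_zero, Nat.sub_self,
    Nat.add_sub_cancel, Nat.cast_one, natCast_succ_p, one_mul, mul_one, add_zero]

/-- `∂^{(0,p,p)} ε = y^{p−1} ω₁ + ω₂^{p²}`. [folklore] -/
theorem hd_B : hasseDeriv (e3 0 p p) (eps p) = monomial (e3 (p - 1) 1 0) 1 + monomial (e3 0 0 (p ^ 2)) 1 := by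
  have h1 : 1 < p := hp.out.one_lt
  rw [eps_eq, map_add, map_add, hasseDeriv_e3_monomial_of_le p (Nat.zero_le _) (by omega) le_rfl,
    hasseDeriv_e3_monomial_of_not_le p (by omega), hasseDeriv_e3_monomial_of_le p le_rfl le_rfl (by omega)]
  simp only [Nat.choose_zero_right, Nat.choose_succ_self_right, Nat.choose_self, Nat.sub_zero, Nat.sub_self,
    Nat.add_sub_cancel, Nat.add_sub_cancel_left, natCast_succ_p, natCast_choose_sq_add, one_mul, mul_one, add_zero]

/-- **The Case-(I) diff-product is `ε + ω₂^{p²+2p}`**: `∂^{(p−1,1,0)}ε · ∂^{(0,p,p)}ε = ε + ω₂^{p²+2p}`. [folklore] -/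
theorem hd_prod : hasseDeriv (e3 (p - 1) 1 0) (eps p) * hasseDeriv (e3 0 p p) (eps p) =
    eps p + monomial (e3 0 0 (p ^ 2 + 2 * p)) 1 := by
  rw [hd_A, hd_B, eps_eq]
  simp only [add_mul, mul_add, monomial_mul_monomial, e3_add, mul_one, add_zero, zero_add]
  have e1 : p + p ^ 2 = p ^ 2 + p := add_comm _ _
  have e2 : 2 * p + p ^ 2 = p ^ 2 + 2 * p := add_comm _ _
  rw [e1, e2]
  abel

/-- `ord ε = 3p`. [folklore] -/
theorem order_eps : (eps p).order = ((3 * p : ℕ) : ℕ∞) := by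
  have h1 : 1 < p := hp.out.one_lt
  have hsq : 3 * p ≤ p ^ 2 + 2 * p := by nlinarith
  apply le_antisymm
  · have hc : coeff (e3 (p - 1) (p + 1) p) (eps p) ≠ 0 := by
      rw [eps_eq, map_add, map_add, coeff_e3_monomial, coeff_e3_monomial, coeff_e3_monomial, if_pos ⟨rfl, rfl, rfl⟩,
        if_neg (by omega), if_neg (by omega)]
      simp
    have := order_le hc
    rw [e3_degree] at this
    rwa [show p - 1 + (p + 1) + p = 3 * p by omega] at this
  · refine MvPowerSeries.le_order fun d hd => ?_
    classical
    have hd' : d.degree < 3 * p := by exact_mod_cast hd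
    rw [eps_eq, map_add, map_add, coeff_monomial, coeff_monomial, coeff_monomial]
    rw [if_neg, if_neg, if_neg, add_zero, add_zero]
    · rintro rfl; rw [e3_degree] at hd'; omega
    · rintro rfl; rw [e3_degree] at hd'; omega
    · rintro rfl; rw [e3_degree] at hd'; omega

/-- `ord_𝔪 ε = 3p`. [folklore] -/
theorem adicOrder_eps : adicOrder (eps p) = ((3 * p : ℕ) : ℕ∞) := by
  rw [adicOrder_eq_order, order_eps]

/-- `ord (ε + ω₂^{p²+2p}) = 3p` (the m-ADIC order of `H♭(ε)` equals `ord ε`: the bound AT `ξ` holds). [folklore] -/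
theorem order_hd_prod : (hasseDeriv (e3 (p - 1) 1 0) (eps p) * hasseDeriv (e3 0 p p) (eps p)).order =
    ((3 * p : ℕ) : ℕ∞) := by
  have h1 : 1 < p := hp.out.one_lt
  have hsq : 3 * p < p ^ 2 + 2 * p := by nlinarith
  rw [hd_prod]
  have hmono : ((3 * p : ℕ) : ℕ∞) < (monomial (e3 0 0 (p ^ 2 + 2 * p)) (1 : ZMod p) : R p).order := by
    rw [order_monomial_of_ne_zero (one_ne_zero), e3_degree, zero_add, zero_add]
    exact_mod_cast hsq
  rw [← order_eps] at hmono ⊢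
  rw [order_add_of_order_ne (ne_of_lt hmono), inf_eq_left.2 (le_of_lt hmono)]

end AlongCentreWitness

end CampaignW21

end Summit.ResolutionOfSingularities.ResolutionOfSingularities.Theorems

end
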